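import Summits.KontsevichZagierPeriods.KontsevichZagierPeriods.Theses.SymplecticScissors
import Literature.NumberTheory.Transcendental.CurvePeriodsStokesProofs
import Literature.NumberTheory.Transcendental.CurvePeriodsAffineLineProofs
import Literature.NumberTheory.Transcendental.CurvePeriodsGmLoopsProofs
import Literature.NumberTheory.Transcendental.OneMotiveToricProofs
import Literature.NumberTheory.Transcendental.CurvePeriodsBakerProofs

/-!
# `CurvePeriodsTransfer` (stmt-KontsevichZagierPeriods-11129) — negative knowledge, part 1: structure of the crux and the load-bearing hypotheses of its antecedent

Support file for the crux `SymplecticScissors.CurvePeriodsTransfer` (cdisprove seat, cycle 1; work file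
`Cruxes/CurvePeriodsTransfer/Disproof.lean`).

STRUCTURE. The crux is LITERALLY `HuberWustholzCurvePeriods → RealOnePeriodRelations` (`transfer_iff'`,
`Iff.rfl`), the antecedent being the body of the cite-only tree fact `HuberWustholzCurvePeriods` (Huber–Wüstholz 2022, Thm 13.3 (2),
elementary rendering of `Literature/NumberTheory/Transcendental/CurvePeriods.lean`) and the consequent the
sibling crux `RealOnePeriodRelations` (stmt-10042) verbatim. Consequently
`¬ CurvePeriodsTransfer ↔ HuberWustholzCurvePeriods ∧ ¬ RealOnePeriodRelations` (`not_transfer_iff`): a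
refutation of the crux proves the Huber–Wüstholz body in Lean, and the crux is a one-line weakening of its
sibling (`realOnePeriodRelations_imp_transfer`).

LOAD-BEARING HYPOTHESES OF THE ANTECEDENT. The antecedent VERBATIM with one of its two hypotheses deleted
is FALSE in both cases (`hwBody_false_without_vanishing`: the unit
symbol has period `1` while elementary relations evaluate to `0` — tree soundness theorem
`IsElementaryRelation.evalCombination_eq_zero`; `hwBody_false_without_algCoeffs`: elementary relations have
ALGEBRAIC coordinates (`isAlgebraic_apply_of_isElementaryRelation`), while the `ℂ`-relation
`2πi·[𝟙] − [(𝔾ₘ, y dx, loop)]` has the transcendental coordinate `2πi` — tree `period_ydx_stdLoop`,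
`transcendental_two_pi_I`). So each deletion makes the corresponding mutated crux VACUOUSLY true
(`transferWithoutVanishing_vacuous`, `transferWithoutAlgCoeffs_vacuous`): the antecedent is exactly as strong
as printed, and no junk-vacuity of the crux was found.

Record (2026-08-17, dependency-drift repair): the crux was DROPPED from the route (2026-08-16T14:16Z, moot); the
token `CurvePeriodsTransfer` is since then a notation scoped to this namespace for the dropped item's statement
(see the comment after the `open` lines); the `open` list keeps only the live sibling `RealOnePeriodRelations`;
no theorem or proof changed.
-/

noncomputable section

open scoped BigOperators
open Complex MvPolynomial
open Literature.NumberTheory.Transcendental Literature.NumberTheory.Transcendental.CurvePeriods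
-- (dependency-drift repair 2026-08-17) `CurvePeriodsTransfer` (stmt-KontsevichZagierPeriods-11129) was DROPPED from the
-- route file on 2026-08-16T14:16Z (moot); only the live sibling crux is opened by name, see the scoped notation below.
open Summit.KontsevichZagierPeriods.KontsevichZagierPeriods.Theses.SymplecticScissors
  (RealOnePeriodRelations)

namespace Summit.KontsevichZagierPeriods.SymplecticScissors.CurvePeriodsTransferNegative

/- **The dropped crux, verbatim, as a notation scoped to this namespace.** The route decl
`Theses.SymplecticScissors.CurvePeriodsTransfer` (stmt-KontsevichZagierPeriods-11129) was dropped from the route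
on 2026-08-16 (items-cap right-size; item closed as moot) and no constant of that name exists any more, while
the negative-knowledge files of this namespace — this file and its importer `Consequent.lean`
(`transfer_iff_dimOne`) — state theorems about it by its bare name. To keep every such theorem letter for
letter (Theorems files are append-only) without declaring a proposition in a Theorems file, the token
`CurvePeriodsTransfer` is a NOTATION SCOPED TO THIS NAMESPACE
(`Summit.KontsevichZagierPeriods.SymplecticScissors.CurvePeriodsTransferNegative`), expanding to the statement of
the dropped item verbatim from its ledger signature — the Huber–Wüstholz body (every `ℂ`-relation with algebraic
coordinates among one-dimensional curve periods is an algebraic combination of elementary relations) IMPLIES the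
sibling crux `RealOnePeriodRelations` (real formal one-periods evaluating to `0` lie in the closure of the KZ
rules plus the semialgebraic Stokes relations), both conjuncts spelled out; `transfer_iff'` below is still
`Iff.rfl` (`HuberWustholzCurvePeriods` and `RealOnePeriodRelations` unfold to that text). The notation is active
exactly where the dropped name used to be consumed (this file and, on re-entering the namespace, its importers)
and nowhere else (`quotPrecheck` is off for this one command only: the binder notations have no precheck
handler; every name in the body is fully qualified). -/
set_option quotPrecheck false in
scoped notation "CurvePeriodsTransfer" =>
  (∀ c : Literature.NumberTheory.Transcendental.CurvePeriods.PeriodSymbol →₀ ℂ, (∀ s, IsAlgebraic ℚ (c s)) → Literature.NumberTheory.Transcendental.CurvePeriods.evalCombination c = 0 → ∃ (k : ℕ) (ρ : Fin k → (Literature.NumberTheory.Transcendental.CurvePeriods.PeriodSymbol →₀ ℂ)) (a : Fin k → ℂ), (∀ l, Literature.NumberTheory.Transcendental.CurvePeriods.IsElementaryRelation (ρ l)) ∧ (∀ l, IsAlgebraic ℚ (a l)) ∧ c = ∑ l, a l • ρ l) → ∀ c : Literature.NumberTheory.Transcendental.KZ.FormalRep, c ∈ AddSubgroup.closure (Set.range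 fun r : Literature.NumberTheory.Transcendental.KZ.IntegralRep 1 => Literature.NumberTheory.Transcendental.KZ.of r) → Literature.NumberTheory.Transcendental.KZ.eval c = 0 → c ∈ AddSubgroup.closure (Literature.NumberTheory.Transcendental.KZ.domainAddRel ∪ Literature.NumberTheory.Transcendental.KZ.integrandAddRel ∪ Literature.NumberTheory.Transcendental.KZ.changeOfVariablesRel ∪ {g : Literature.NumberTheory.Transcendental.KZ.FormalRep | ∃ (Δ : Set (Fin 2 → ℝ)) (A B S : (Fin 2 → ℝ) → ℝ) (r₀₁ r₁₂ r₀₂ : Literature.NumberTheory.Transcendental.KZ.IntegralRep 1), Δ = {p | 0 ≤ p 0 ∧ 0 ≤ p 1 ∧ p 0 + p 1 ≤ 1} ∧ Literature.NumberTheory.Transcendental.IsSemialgebraicFunOn ℚ Δ A ∧ Literature.NumberTheory.Transcendental.IsSemialgebraicFunOn ℚ Δ B ∧ ContinuousOn A Δ ∧ ContinuousOn B Δ ∧ (∀ p : Fin 2 → ℝ, 0 < p 0 → 0 < p 1 → p 0 + p 1 < 1 → HasFDerivAt S (A p • ContinuousLinearMap.proj (R := ℝ) (φ := fun _ : Fin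 2 => ℝ) 0 + B p • ContinuousLinearMap.proj (R := ℝ) (φ := fun _ : Fin 2 => ℝ) 1) p) ∧ r₀₁.domain = {z | z 0 ∈ Set.Ioo 0 1} ∧ r₁₂.domain = {z | z 0 ∈ Set.Ioo 0 1} ∧ r₀₂.domain = {z | z 0 ∈ Set.Ioo 0 1} ∧ (∀ z ∈ r₀₁.domain, r₀₁.integrand z = A ![z 0, 0]) ∧ (∀ z ∈ r₁₂.domain, r₁₂.integrand z = B ![1 - z 0, z 0] - A ![1 - z 0, z 0]) ∧ (∀ z ∈ r₀₂.domain, r₀₂.integrand z = B ![0, z 0]) ∧ g = Literature.NumberTheory.Transcendental.KZ.of r₀₁ + Literature.NumberTheory.Transcendental.KZ.of r₁₂ - Literature.NumberTheory.Transcendental.KZ.of r₀₂})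

/-! ## §1 Structure of the crux -/

/-- The crux is literally `HuberWustholzCurvePeriods → RealOnePeriodRelations`. [folklore] -/
theorem transfer_iff' :
    CurvePeriodsTransfer ↔ (HuberWustholzCurvePeriods → RealOnePeriodRelations) :=
  Iff.rfl

/-- The crux is a one-line WEAKENING of its sibling crux `RealOnePeriodRelations` (stmt-10042). [folklore] -/
theorem realOnePeriodRelations_imp_transfer : RealOnePeriodRelations → CurvePeriodsTransfer :=
  fun h _ => h

/-- **What a refutation of the crux would mean**: `¬ CurvePeriodsTransfer` is equivalent to
`HuberWustholzCurvePeriods ∧ ¬ RealOnePeriodRelations`; in particular any Lean refutation of the crux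
contains a Lean proof of the Huber–Wüstholz body. [folklore] -/
theorem not_transfer_iff :
    ¬ CurvePeriodsTransfer ↔ (HuberWustholzCurvePeriods ∧ ¬ RealOnePeriodRelations) := by
  rw [transfer_iff']
  push Not
  exact Iff.rfl

/-- A refutation of the crux proves the Huber–Wüstholz body. [folklore] -/
theorem hwBody_of_not_transfer (h : ¬ CurvePeriodsTransfer) : HuberWustholzCurvePeriods :=
  (not_transfer_iff.mp h).1

/-! ## §2 Load-bearing hypotheses of the antecedent -/

/-- A coordinate of a symbol vector `single x 1` is `0` or `1`, hence algebraic. [folklore] -/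
theorem isAlgebraic_single_one_apply (x s : PeriodSymbol) :
    IsAlgebraic ℚ (Finsupp.single x (1 : ℂ) s) := by
  classical
  rw [Finsupp.single_apply]
  split_ifs
  exacts [isAlgebraic_one, isAlgebraic_zero]

/-- **`evalCombination c = 0` is load-bearing in the antecedent**: without it the unit symbol `𝟙`
(period `1`) would be a `ℚ̄`-combination of elementary relations, all of which evaluate to `0`
(tree: `evalCombination_eq_zero_of_isElementaryRelation`, `period_unit`). [folklore] -/
theorem hwBody_false_without_vanishing :
    ¬ (∀ c : PeriodSymbol →₀ ℂ, (∀ s, IsAlgebraic ℚ (c s)) →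
        ∃ (k : ℕ) (ρ : Fin k → (PeriodSymbol →₀ ℂ)) (a : Fin k → ℂ),
          (∀ l, IsElementaryRelation (ρ l)) ∧ (∀ l, IsAlgebraic ℚ (a l)) ∧ c = ∑ l, a l • ρ l) := by
  intro h
  obtain ⟨k, ρ, a, hρ, -, hc⟩ :=
    h (Finsupp.single PeriodSymbol.unit 1) (fun s => isAlgebraic_single_one_apply _ s)
  have h0 := evalCombination_eq_zero_of_isElementaryRelation ρ a hρ
  rw [← hc, evalCombination_single, period_unit, mul_one] at h0
  exact one_ne_zero h0

/-- Hence the crux with `evalCombination c = 0` deleted from its antecedent is VACUOUSLY true (junk, not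
information). [folklore] -/
theorem transferWithoutVanishing_vacuous :
    (∀ c : PeriodSymbol →₀ ℂ, (∀ s, IsAlgebraic ℚ (c s)) →
        ∃ (k : ℕ) (ρ : Fin k → (PeriodSymbol →₀ ℂ)) (a : Fin k → ℂ),
          (∀ l, IsElementaryRelation (ρ l)) ∧ (∀ l, IsAlgebraic ℚ (a l)) ∧ c = ∑ l, a l • ρ l) →
      RealOnePeriodRelations :=
  fun h => (hwBody_false_without_vanishing h).elim

/-- **Elementary relations have algebraic coordinates**: every coordinate of an (R1)–(R5) vector is a
`ℤ`-combination of `1`, an algebraic scalar `a` (R1b) or `P(γ(1)) − P(γ(0))` with `P` over `ℚ̄` and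
`γ(0), γ(1) ∈ ℚ̄ⁿ` (R3; tree `HasAlgCoeffs.isAlgebraic_eval`). [folklore] -/
theorem isAlgebraic_apply_of_isElementaryRelation {ρ : PeriodSymbol →₀ ℂ} (hρ : IsElementaryRelation ρ)
    (s : PeriodSymbol) : IsAlgebraic ℚ (ρ s) := by
  cases hρ with
  | add Z hZ γ ω ω₁ ω₂ h h₁ h₂ hω =>
    simp only [Finsupp.sub_apply]
    exact ((isAlgebraic_single_one_apply _ _).sub (isAlgebraic_single_one_apply _ _)).sub
      (isAlgebraic_single_one_apply _ _)
  | smul Z hZ γ a ha ω ω' h h' hω =>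
    simp only [Finsupp.sub_apply, Finsupp.smul_apply, smul_eq_mul]
    exact (isAlgebraic_single_one_apply _ _).sub (ha.mul (isAlgebraic_single_one_apply _ _))
  | vanish Z hZ γ ω h hv => exact isAlgebraic_single_one_apply _ _
  | exact Z hZ γ P hP ω h hω =>
    simp only [Finsupp.sub_apply, Finsupp.smul_apply, smul_eq_mul]
    exact (isAlgebraic_single_one_apply _ _).sub
      (((hP.isAlgebraic_eval γ.algebraic_one).sub (hP.isAlgebraic_eval γ.algebraic_zero)).mul
        (isAlgebraic_single_one_apply _ _))
  | pushforward Z Z' hZ hZ' f hf hfZ ω' h' ω h hω γ γ' hγ' =>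
    simp only [Finsupp.sub_apply]
    exact (isAlgebraic_single_one_apply _ _).sub (isAlgebraic_single_one_apply _ _)
  | boundary Z hZ ω h τ hτ hτZ e₀₁ e₁₂ e₀₂ h₀₁ h₁₂ h₀₂ =>
    simp only [Finsupp.sub_apply, Finsupp.add_apply]
    exact ((isAlgebraic_single_one_apply _ _).add (isAlgebraic_single_one_apply _ _)).sub
      (isAlgebraic_single_one_apply _ _)

/-- Coordinates of a `ℚ̄`-combination of elementary relations are algebraic. [folklore] -/
theorem isAlgebraic_sum_smul_apply {k : ℕ} (ρ : Fin k → (PeriodSymbol →₀ ℂ)) (a : Fin k → ℂ)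
    (hρ : ∀ l, IsElementaryRelation (ρ l)) (ha : ∀ l, IsAlgebraic ℚ (a l)) (s : PeriodSymbol) :
    IsAlgebraic ℚ ((∑ l, a l • ρ l) s) := by
  rw [Finsupp.finsetSum_apply]
  exact isAlgebraic_finsetSum _ _ fun l _ => by
    rw [Finsupp.smul_apply, smul_eq_mul]
    exact (ha l).mul (isAlgebraic_apply_of_isElementaryRelation (hρ l) s)

/-- The loop symbol `(𝔾ₘ = {xy = 1}, y dx, Λ)`, `Λ(t) = (e^{2πit}, e^{-2πit})`, has period `2πi`
(tree `exists_stdLoop`, `period_ydx_stdLoop`). [cite: HuberWustholz2022, §10.1 (p. 96)] -/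
theorem exists_loopSymbol : ∃ L : PeriodSymbol, L.period = 2 * Real.pi * I ∧ L.Z.n = 2 := by
  obtain ⟨Λ, hΛ⟩ := exists_stdLoop isAlgebraic_one one_ne_zero 1
  refine ⟨⟨⟨2, 1, ![X 0 * X 1 - 1]⟩, isSmoothAffineCurve_mulGroup, ![X 1, 0], hasAlgCoeffs_ydx, Λ⟩,
    ?_, rfl⟩
  have h := period_ydx_stdLoop one_ne_zero 1 Λ hΛ
  simpa using h

/-- **`∀ s, IsAlgebraic ℚ (c s)` is load-bearing in the antecedent**: the `ℂ`-linear relation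
`c = 2πi·[𝟙] − [(𝔾ₘ, y dx, Λ)]` vanishes, but `c 𝟙 = 2πi` is transcendental (Lindemann; tree
`transcendental_two_pi_I`), whereas every `ℚ̄`-combination of elementary relations has algebraic
coordinates. [folklore] -/
theorem hwBody_false_without_algCoeffs :
    ¬ (∀ c : PeriodSymbol →₀ ℂ, evalCombination c = 0 →
        ∃ (k : ℕ) (ρ : Fin k → (PeriodSymbol →₀ ℂ)) (a : Fin k → ℂ),
          (∀ l, IsElementaryRelation (ρ l)) ∧ (∀ l, IsAlgebraic ℚ (a l)) ∧ c = ∑ l, a l • ρ l) := by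
  intro h
  obtain ⟨L, hL, hLn⟩ := exists_loopSymbol
  have hne : PeriodSymbol.unit ≠ L := by
    intro e
    have h1 : PeriodSymbol.unit.Z.n = 1 := rfl
    rw [e, hLn] at h1
    exact absurd h1 (by decide)
  set c : PeriodSymbol →₀ ℂ :=
    (2 * Real.pi * I) • Finsupp.single PeriodSymbol.unit 1 - Finsupp.single L 1 with hc_def
  have hc0 : evalCombination c = 0 := by
    rw [hc_def, evalCombination_sub, evalCombination_smul, evalCombination_single,
      evalCombination_single, period_unit, hL]
    ring
  obtain ⟨k, ρ, a, hρ, ha, hc⟩ := h c hc0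
  have halg : IsAlgebraic ℚ (c PeriodSymbol.unit) := by
    rw [hc]
    exact isAlgebraic_sum_smul_apply ρ a hρ ha _
  have hcu : c PeriodSymbol.unit = 2 * Real.pi * I := by
    rw [hc_def, Finsupp.sub_apply, Finsupp.smul_apply, Finsupp.single_eq_same,
      Finsupp.single_eq_of_ne hne, smul_eq_mul, mul_one, sub_zero]
  exact transcendental_two_pi_I (hcu ▸ halg)

/-- Hence the crux with `∀ s, IsAlgebraic ℚ (c s)` deleted from its antecedent is VACUOUSLY true (junk,
not information). [folklore] -/
theorem transferWithoutAlgCoeffs_vacuous :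
    (∀ c : PeriodSymbol →₀ ℂ, evalCombination c = 0 →
        ∃ (k : ℕ) (ρ : Fin k → (PeriodSymbol →₀ ℂ)) (a : Fin k → ℂ),
          (∀ l, IsElementaryRelation (ρ l)) ∧ (∀ l, IsAlgebraic ℚ (a l)) ∧ c = ∑ l, a l • ρ l) →
      RealOnePeriodRelations :=
  fun h => (hwBody_false_without_algCoeffs h).elim

end Summit.KontsevichZagierPeriods.SymplecticScissors.CurvePeriodsTransferNegative

end
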